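import Summits.CriticalPhenomena.PercolationContinuityZ3.Theorems.PercNearOneGluingNoHeavyQuantGluedWindowFarTop
import Summits.CriticalPhenomena.PercolationContinuityZ3.Theorems.PercNearOneGluingNoHeavyQuantGluedWindowDiagCore
import HarnessLib

/-!
# QUANT lane R8, T-DEC: LEMMA W's pair condition — the two-row h-mid regime with the TOP COPY UNREACHABLE (`2l + r + k ≤ T`), the pair heavy or
# incompatible at the glued target (`y(h−l) ≤ T−2l`), the middle copy reaching `h` (`T < l+r+h`) and `h + r` a GIANT (`j < h + r`): the DIAGONAL / POOL
# certificate when the middle copy is heavy for `h` or not lighter for `h` than the pair at `T₀` (arm-1 gen 62, architect)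

builds on p205010 (kernel theorem, internal audit signed; external expert review pending)

Support file (`--supports stmt-CriticalPhenomena-4575`), QUANT lane seat prim-quant-arm-1 (gen 62, architect); memo
`run/shared/lean/prim/quant/prim-quant-arm-1-g62/ARCH-G62.md` §1–§4.  Theorems only; standard axioms, no sorries, no definitions.

THE CELL.  As `…QuantGluedWindowNoTopHeavy` (p641292) but with `h + r > j`: the two giant copies `h+r`, `h+r+k` of `h` form the POOL (capacity `γ(t₁+t₂)`),
into which — `c ≥ h` being cheap — the middle copy `l+r` ships at the DISCOUNTED rate `min(y/(1−y), usage(l+r, h))` (`pool_bound`, arm-1 g60's reduction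
`gluedPullback_windowPair_twoRow_mid_of_assign` with `ι = 1`).  Certificate: row `l` ↦ all of `h` at the exact heavy power (nothing if `N ≥ d`), remainder ↦
pool at `(1−y)/y`; row `l+r` ↦ pool at `(1−y)/y` if `(l+r, h)` is heavy at `T`, at the exact light power `(1−G_h)/G_h` (`G_h = y² + (1−y)ρ_h`,
`ρ_h = (T−2l−2r)/(h−l−r)`) if light.  Inequalities: heavy middle copy — `diag_twoCopy` with ratios `(ν, y)` (the band gives `t₀ν + t₁y ≤ ρ₀`); light middle
copy with `ρ_h ≥ ρ₀` — **`diag_poolLight`**: `t₀(1−γ/ν)·y/(1−y) + t₁(G_h−γ)/(1−G_h) ≤ γt₂` from `t₀ν + t₁ρ_h ≤ ρ₀`, `ρ₀ ≤ ρ_h ≤ y ≤ ν ≤ 2`, `t₂ ≥ y`, by a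
34-term Handelman certificate (**`diag_poolLight_poly`**, kit j310619, typer g23 / arm-1 g60 pipeline, exact rational weights, identity verified exactly; a-free
reduction validated by the exact census explore2/iota1.py, v1l.py: 0 failures).
**`gluedPullback_windowPair_twoRow_noTop_giantG`**: the pair condition, no `GluedLemmaW`, under the side condition `yΔ ≤ T−2l−2r ∨ (T₀−2l)Δ ≤ (T−2l−2r)(h−l)`
(`Δ = h−l−r`; the complementary case — middle copy light for `h` AND lighter than the pair at `T₀` — needs the midpoint form of the band fact, memo §4, OPEN).

HONEST STATUS.  `GluedLemmaW` (flow form), `GluedDominatedMass`, the band, `SiblingStep`, `FarTreeRow` OPEN; RATE class (log\*) / honest sentence of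
`run/shared/lean/prim/quant/README.md` unchanged.  [this work].  Nothing here is cited as a published result.  The gluing rows served
[cite: KozmaNitzan2024, Conjecture 3 (p. 15)]; product measure [cite: Grimmett1999, §1.3 p. 10].
-/

set_option maxHeartbeats 4000000

noncomputable section

namespace Summit.CriticalPhenomena.PercolationContinuityZ3.Theorems
namespace Quant
namespace LawDec

set_option maxRecDepth 200000 in
/-- **the cleared polynomial of `diag_poolLight`** (`g = γ`, `H = G_h`, `n = ν`): 34-term Handelman certificate (kit j310619) on the generators
`y, 1−y, t₁, t₀, t₂−y, ν−y, H−g, y−H, g−y², (g−y²) − (1−y)t₀ν − t₁(H−y²), 2−ν`. [this work] -/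
theorem diag_poolLight_poly (y t1 t2 n g H : ℝ) (h0 : 0 ≤ y) (h1 : 0 ≤ 1 - y) (h2 : 0 ≤ t1) (h3 : 0 ≤ 1 - t1 - t2) (h4 : 0 ≤ t2 - y) (h5 : 0 ≤ n - y) (h6 : 0 ≤ H - g) (h7 : 0 ≤ y - H) (h8 : 0 ≤ g - y ^ 2) (h9 : 0 ≤ (g - y ^ 2) - (1 - y) * (1 - t1 - t2) * n - t1 * (H - y ^ 2)) (h10 : 0 ≤ 2 - n) :
    0 ≤ g * t2 * n * (1 - y) * (1 - H) - (1 - t1 - t2) * y * (n - g) * (1 - H) - t1 * n * (1 - y) * (H - g) := by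
  linarith only [mul_nonneg (mul_nonneg (mul_nonneg (mul_nonneg (mul_nonneg (h0) h0) h0) h2) h5) h7,
    mul_nonneg (mul_nonneg (mul_nonneg (mul_nonneg (mul_nonneg (h0) h0) h0) h7) h7) (by norm_num : (0:ℝ) ≤ 3/2),
    mul_nonneg (mul_nonneg (mul_nonneg (mul_nonneg (h0) h0) h2) h5) h6,
    mul_nonneg (mul_nonneg (mul_nonneg (mul_nonneg (h0) h0) h2) h5) h7,
    mul_nonneg (mul_nonneg (mul_nonneg (mul_nonneg (mul_nonneg (mul_nonneg (h0) h0) h3) h7) h7) h10) (by norm_num : (0:ℝ) ≤ 1/2),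
    mul_nonneg (mul_nonneg (mul_nonneg (mul_nonneg (h0) h0) h4) h5) h7,
    mul_nonneg (mul_nonneg (mul_nonneg (mul_nonneg (h0) h0) h4) h6) h7,
    mul_nonneg (mul_nonneg (mul_nonneg (mul_nonneg (h0) h0) h4) h7) h7,
    mul_nonneg (mul_nonneg (mul_nonneg (mul_nonneg (h0) h0) h6) h7) (by norm_num : (0:ℝ) ≤ 3),
    mul_nonneg (mul_nonneg (mul_nonneg (mul_nonneg (h0) h0) h7) h7) (by norm_num : (0:ℝ) ≤ 1/2),
    mul_nonneg (mul_nonneg (mul_nonneg (mul_nonneg (h0) h1) h3) h4) h5,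
    mul_nonneg (mul_nonneg (mul_nonneg (mul_nonneg (h0) h1) h6) h7) h10,
    mul_nonneg (mul_nonneg (h0) h1) h9,
    mul_nonneg (mul_nonneg (mul_nonneg (mul_nonneg (h0) h2) h5) h6) h7,
    mul_nonneg (mul_nonneg (mul_nonneg (mul_nonneg (h0) h2) h5) h7) h8,
    mul_nonneg (mul_nonneg (mul_nonneg (mul_nonneg (mul_nonneg (h0) h2) h6) h7) h7) (by norm_num : (0:ℝ) ≤ 1/2),
    mul_nonneg (mul_nonneg (mul_nonneg (mul_nonneg (mul_nonneg (h0) h2) h7) h7) h8) (by norm_num : (0:ℝ) ≤ 1/2),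
    mul_nonneg (mul_nonneg (mul_nonneg (mul_nonneg (mul_nonneg (h0) h3) h7) h7) h10) (by norm_num : (0:ℝ) ≤ 1/2),
    mul_nonneg (mul_nonneg (mul_nonneg (h0) h4) h5) h6,
    mul_nonneg (mul_nonneg (mul_nonneg (mul_nonneg (h0) h4) h5) h6) h7,
    mul_nonneg (mul_nonneg (mul_nonneg (h0) h4) h5) h7,
    mul_nonneg (mul_nonneg (mul_nonneg (h0) h4) h7) h7,
    mul_nonneg (mul_nonneg (h0) h6) h6,
    mul_nonneg (mul_nonneg (mul_nonneg (mul_nonneg (h0) h6) h7) h7) (by norm_num : (0:ℝ) ≤ 1/2),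
    mul_nonneg (mul_nonneg (h0) h6) h9,
    mul_nonneg (mul_nonneg (mul_nonneg (mul_nonneg (h0) h7) h7) h7) (by norm_num : (0:ℝ) ≤ 1/2),
    mul_nonneg (mul_nonneg (mul_nonneg (mul_nonneg (h0) h7) h7) h9) (by norm_num : (0:ℝ) ≤ 1/2),
    mul_nonneg (mul_nonneg (mul_nonneg (h0) h7) h9) (by norm_num : (0:ℝ) ≤ 2),
    mul_nonneg (mul_nonneg (mul_nonneg (mul_nonneg (h1) h2) h3) h5) h5,
    mul_nonneg (mul_nonneg (mul_nonneg (mul_nonneg (h1) h3) h4) h5) h5,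
    mul_nonneg (mul_nonneg (mul_nonneg (h2) h3) h5) h7,
    mul_nonneg (mul_nonneg (h2) h5) h9,
    mul_nonneg (mul_nonneg (mul_nonneg (h4) h5) h7) h8,
    mul_nonneg (mul_nonneg (h4) h5) h9]

/-- **POOL-LIGHT INEQUALITY** (ι = 1, middle copy light for `h`, not lighter than the pair at `T₀`): `0 < y < 1`, `γ = y² + (1−y)ρ₀`, `G_h = y² + (1−y)ρ_h`,
`0 < ρ₀ ≤ ρ_h ≤ y ≤ ν ≤ 2`, `t₀, t₁ ≥ 0`, `t₂ = 1 − t₀ − t₁ ≥ y`, `t₀ν + t₁ρ_h ≤ ρ₀` ⟹ `t₀(1 − γ/ν)·y/(1−y) + t₁(G_h − γ)/(1 − G_h) ≤ γ·t₂`. [this work] -/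
theorem diag_poolLight (y ρ ρh t0 t1 n : ℝ) (hy0 : 0 < y) (hy1 : y < 1) (hρ0 : 0 < ρ) (hρh : ρ ≤ ρh) (hρhy : ρh ≤ y) (hn : y ≤ n) (hn2 : n ≤ 2)
    (ht0 : 0 ≤ t0) (ht1 : 0 ≤ t1) (ht2 : y ≤ 1 - t0 - t1) (hsum : t0 * n + t1 * ρh ≤ ρ) :
    t0 * (1 - (y ^ 2 + (1 - y) * ρ) / n) * (y / (1 - y)) + t1 * ((y ^ 2 + (1 - y) * ρh) - (y ^ 2 + (1 - y) * ρ)) / (1 - (y ^ 2 + (1 - y) * ρh))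
      ≤ (y ^ 2 + (1 - y) * ρ) * (1 - t0 - t1) := by
  obtain ⟨g, hg⟩ : ∃ g : ℝ, g = y ^ 2 + (1 - y) * ρ := ⟨_, rfl⟩
  obtain ⟨H, hH⟩ : ∃ H : ℝ, H = y ^ 2 + (1 - y) * ρh := ⟨_, rfl⟩
  have h1y : 0 < 1 - y := by linarith
  have hn0 : 0 < n := lt_of_lt_of_le hy0 hn
  have hHy : H ≤ y := by rw [hH]; nlinarith [mul_le_mul_of_nonneg_left hρhy h1y.le]
  have hH1 : 0 < 1 - H := by linarith
  rw [← hg, ← hH]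
  have P := diag_poolLight_poly y t1 (1 - t0 - t1) n g H hy0.le h1y.le ht1 (by linarith) (by linarith) (by linarith)
    (by rw [hg, hH]; nlinarith [mul_le_mul_of_nonneg_left hρh h1y.le]) (sub_nonneg.2 hHy) (by rw [hg]; nlinarith [mul_pos h1y hρ0])
    (by rw [hg, hH]; nlinarith [mul_le_mul_of_nonneg_left hsum h1y.le]) (by linarith)
  rw [show 1 - t1 - (1 - t0 - t1) = t0 by ring] at P
  -- divide by n (1−y) (1−H) > 0
  have hden : 0 < n * (1 - y) * (1 - H) := by positivity
  have key : (t0 * (1 - g / n) * (y / (1 - y)) + t1 * (H - g) / (1 - H)) * (n * (1 - y) * (1 - H))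
      = t0 * y * (n - g) * (1 - H) + t1 * n * (1 - y) * (H - g) := by
    have hn' : n ≠ 0 := hn0.ne'
    have hy' : 1 - y ≠ 0 := h1y.ne'
    have hH' : 1 - H ≠ 0 := hH1.ne'
    rw [add_mul]
    have a1 : t0 * (1 - g / n) * (y / (1 - y)) * (n * (1 - y) * (1 - H)) = t0 * y * (n - g) * (1 - H) := by
      rw [one_sub_div hn']; field_simp
    have a2 : t1 * (H - g) / (1 - H) * (n * (1 - y) * (1 - H)) = t1 * n * (1 - y) * (H - g) := by
      field_simp
    rw [a1, a2]
  have key2 : g * (1 - t0 - t1) * (n * (1 - y) * (1 - H)) = g * (1 - t0 - t1) * n * (1 - y) * (1 - H) := by ring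
  refine le_of_mul_le_mul_right ?_ hden
  rw [key, key2]; linarith [P]

/-- **TWO-ROW REGIME, h MID, TOP COPY UNREACHABLE, `h + r` A GIANT**: `2l + r + k ≤ T`, `y(h−l) ≤ T−2l`, `T < l + r + h`, `j < h + r`, and the middle
copy heavy for `h` at `T` or not lighter for `h` than the pair `(l,h)` at `T₀` ⟹ `(1−γ)Ψ(l) + γΨ(h) ≤ 0` for every price system and every cheap `c ≥ h`.
[this work] -/
theorem gluedPullback_windowPair_twoRow_noTop_giantG (x a q g S : ℝ) (B r k j l h c ls : ℕ) (α p : ℕ → ℝ)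
    (hx0 : 0 < x) (hx1 : x < 1) (ha0 : 0 < a) (ha1 : a ≤ 1) (hq0 : 0 < q) (hq1 : q < 1) (hg0 : 0 ≤ g) (hg1 : g ≤ 1) (hr : 1 ≤ r)
    (hxqg : x ≤ q * g)
    (hlh : l < h) (hhB : h ≤ B) (hhj : h ≤ j) (hwin : j < h + r + k) (hlow : 2 * (l : ℝ) < a * S) (hcomp : a * S < (l : ℝ) + h)
    (hlight : pairGate (a * x) (a * S) l h < a * x)
    (hL2j : l + r + k ≤ j) (hL2mid : a * (S + q * ((r : ℝ) + k * g)) ≤ 2 * ((l : ℝ) + r + k))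
    (hL1low : 2 * ((l : ℝ) + r) < a * (S + q * ((r : ℝ) + k * g))) (hhmid : a * (S + q * ((r : ℝ) + k * g)) ≤ 2 * (h : ℝ))
    (hincl : 2 * (l : ℝ) + r + k ≤ a * (S + q * ((r : ℝ) + k * g)))
    (hheavyT : (a * x) * ((h : ℝ) - l) ≤ a * (S + q * ((r : ℝ) + k * g)) - 2 * (l : ℝ))
    (hcompat1 : a * (S + q * ((r : ℝ) + k * g)) < (l : ℝ) + r + h) (hjr : j < h + r)
    (hside : (a * x) * ((h : ℝ) - l - r) ≤ a * (S + q * ((r : ℝ) + k * g)) - 2 * ((l : ℝ) + r) ∨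
      (a * S - 2 * (l : ℝ)) * ((h : ℝ) - l - r) ≤ (a * (S + q * ((r : ℝ) + k * g)) - 2 * ((l : ℝ) + r)) * ((h : ℝ) - l))
    (hhc : h ≤ c) (hcB : c ≤ B) (hcj : c ≤ j)
    (hp : ∀ h, 0 ≤ p h)
    (hαp : ∀ l' h', l' ≤ j → 2 * (l' : ℝ) < a * (S + q * ((r : ℝ) + k * g)) → h' ≤ B + (r + k) →
      (j + 1 ≤ h' ∨ a * (S + q * ((r : ℝ) + k * g)) < (l' : ℝ) + h') →
      α l' ≤ usage (a * x) (a * (S + q * ((r : ℝ) + k * g))) j l' h' * p h')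
    (hcheap : -(gluedPullback (a * (S + q * ((r : ℝ) + k * g))) q g j r k α p c) * (a * x)
      < (1 - a * x) * gluedPullback (a * (S + q * ((r : ℝ) + k * g))) q g j r k α p ls) :
    (1 - pairGate (a * x) (a * S) l h) * gluedPullback (a * (S + q * ((r : ℝ) + k * g))) q g j r k α p l
      + pairGate (a * x) (a * S) l h * gluedPullback (a * (S + q * ((r : ℝ) + k * g))) q g j r k α p h ≤ 0 := by
  obtain ⟨y, hy⟩ : ∃ y : ℝ, y = a * x := ⟨_, rfl⟩
  obtain ⟨T, hT⟩ : ∃ T : ℝ, T = a * (S + q * ((r : ℝ) + k * g)) := ⟨_, rfl⟩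
  obtain ⟨T₀, hT₀⟩ : ∃ T₀ : ℝ, T₀ = a * S := ⟨_, rfl⟩
  have hy0 : 0 < y := by rw [hy]; exact mul_pos ha0 hx0
  have hyx : y ≤ x := by rw [hy]; nlinarith
  have hy1 : y < 1 := by linarith
  have h1y : 0 < 1 - y := by linarith
  obtain ⟨t1, ht1⟩ : ∃ t1 : ℝ, t1 = q * (1 - g) := ⟨_, rfl⟩
  obtain ⟨t2, ht2⟩ : ∃ t2 : ℝ, t2 = q * g := ⟨_, rfl⟩
  have ht1p : 0 ≤ t1 := by rw [ht1]; exact mul_nonneg hq0.le (by linarith)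
  have ht2p : 0 ≤ t2 := by rw [ht2]; exact mul_nonneg hq0.le hg0
  have et0 : 1 - t1 - t2 = 1 - q := by rw [ht1, ht2]; ring
  have ht0p : 0 ≤ 1 - t1 - t2 := by rw [et0]; linarith
  have hyt2 : y ≤ t2 := by rw [ht2]; linarith
  have hr1 : (1:ℝ) ≤ r := by exact_mod_cast hr
  have hr0 : (0:ℝ) ≤ r := by linarith
  have hk0 : (0:ℝ) ≤ k := Nat.cast_nonneg k
  have hlh' : (l : ℝ) < h := by exact_mod_cast hlh
  -- geometry
  obtain ⟨d, hd⟩ : ∃ d : ℝ, d = (h : ℝ) - l := ⟨_, rfl⟩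
  have hd0 : 0 < d := by rw [hd]; linarith
  obtain ⟨N, hN⟩ : ∃ N : ℝ, N = T - 2 * (l : ℝ) := ⟨_, rfl⟩
  have hA : T - T₀ = a * (q * ((r : ℝ) + k * g)) := by rw [hT, hT₀]; ring
  have em : q * (1 - g) * (r : ℝ) + q * g * ((r : ℝ) + k) = q * ((r : ℝ) + k * g) := by ring
  have hAm : T - T₀ ≤ t1 * r + t2 * ((r : ℝ) + k) := by
    rw [hA, ht1, ht2]
    have h1 : a * (q * ((r : ℝ) + k * g)) ≤ 1 * (q * ((r : ℝ) + k * g)) :=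
      mul_le_mul_of_nonneg_right ha1 (by positivity)
    linarith [h1, em]
  have hNK : (r : ℝ) + k ≤ N := by rw [hN, hT]; linarith
  have hNyd : y * d ≤ N := by rw [hN, hd, hT, hy]; exact hheavyT
  have hNdr : N < d + r := by rw [hN, hd, hT]; linarith [hcompat1]
  have h2rN : 2 * (r : ℝ) < N := by rw [hN, hT]; linarith
  have hN2d : N ≤ 2 * d := by rw [hN, hd, hT]; linarith
  have hN0 : 0 < N := by linarith
  have hAN : T - T₀ ≤ t1 * r + t2 * N := by nlinarith [hAm, mul_le_mul_of_nonneg_left hNK ht2p]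
  have hdr : (r : ℝ) < d := by linarith
  -- the light gate of the first factor
  obtain ⟨ρ₀, hρ₀⟩ : ∃ ρ₀ : ℝ, ρ₀ = (T₀ - 2 * (l : ℝ)) / ((h : ℝ) - l) := ⟨_, rfl⟩
  have hρ₀y : ρ₀ < y := by
    have : (T₀ - 2 * (l : ℝ)) / ((h : ℝ) - l) ≤ pairGate y T₀ l h := le_max_left _ _
    rw [hρ₀]; rw [hy, hT₀] at this ⊢; linarith
  obtain ⟨γ, hγ⟩ : ∃ γ : ℝ, γ = y ^ 2 + (1 - y) * ρ₀ := ⟨_, rfl⟩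
  have hγ' : pairGate (a * x) (a * S) l h = γ := by
    rw [hγ, hρ₀, hT₀, hy]; exact pairGate_eq_light (a * x) (a * S) l h (mul_pos ha0 hx0).le (by rw [← hy, ← hT₀, ← hρ₀]; exact hρ₀y.le)
  have eρ₀ : ρ₀ = (N - (T - T₀)) / d := by rw [hρ₀, hN, hd]; congr 1; ring
  have eρ₀d : ρ₀ * d = N - (T - T₀) := by rw [eρ₀, div_mul_cancel₀ _ hd0.ne']
  have hρ₀0 : 0 < ρ₀ := by rw [hρ₀]; exact div_pos (by rw [hT₀]; linarith) (by linarith)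
  have hγ0 : 0 < γ := by rw [hγ]; positivity
  have hγy : γ < y := by rw [hγ]; nlinarith [mul_lt_mul_of_pos_left hρ₀y h1y]
  have h1γ : 0 < 1 - γ := by linarith
  have hlowl : 2 * (l : ℝ) < T := by linarith
  have eLr : ((l + r : ℕ) : ℝ) = (l : ℝ) + r := by push_cast; ring
  have hlowlr : 2 * ((l + r : ℕ) : ℝ) < T := by rw [eLr]; linarith
  have hcomp1 : T < ((l + r : ℕ) : ℝ) + h := by rw [eLr]; rw [hT]; exact hcompat1
  -- box coordinates: ν = N/d, ρ_h = (N−2r)/(d−r)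
  obtain ⟨nu, hnu⟩ : ∃ nu : ℝ, nu = N / d := ⟨_, rfl⟩
  obtain ⟨rh, hrh⟩ : ∃ rh : ℝ, rh = (N - 2 * (r : ℝ)) / (d - r) := ⟨_, rfl⟩
  have hnuy : y ≤ nu := by rw [hnu, le_div_iff₀ hd0]; exact hNyd
  have hn0 : 0 < nu := lt_of_lt_of_le hy0 hnuy
  have hnu2 : nu ≤ 2 := by rw [hnu, div_le_iff₀ hd0]; linarith
  have hdr0 : 0 < d - r := by linarith
  have hrh0 : 0 < rh := by rw [hrh]; exact div_pos (by linarith) hdr0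
  have erh : (T - 2 * ((l + r : ℕ) : ℝ)) / ((h : ℝ) - ((l + r : ℕ) : ℝ)) = rh := by
    rw [hrh, hN, hd, eLr]; congr 1 <;> ring
  have hγn : γ / nu ≤ 1 := by rw [div_le_one hn0]; linarith
  -- pool power and row l into h
  obtain ⟨pu, hpu⟩ : ∃ pu : ℝ, pu = (1 - y) / y := ⟨_, rfl⟩
  have hpu0 : 0 < pu := by rw [hpu]; exact div_pos h1y hy0
  have vP : pu * (y / (1 - y)) ≤ 1 := by rw [hpu, div_mul_div_comm, mul_comm (1 - y) y, div_self (mul_ne_zero hy0.ne' h1y.ne')]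
  have epu : ∀ z : ℝ, z / pu = z * (y / (1 - y)) := fun z => by rw [hpu, div_div_eq_mul_div, mul_div_assoc]
  obtain ⟨ph, hph0, vH, hcH, hL0, hL0'⟩ : ∃ ph : ℝ, 0 ≤ ph ∧ ph * usage y T j l h ≤ 1 ∧ (ph = 0 ∨ T < (l : ℝ) + h) ∧
      0 ≤ (1 - γ) * (1 - t1 - t2) - γ * (1 - t1 - t2) * ph ∧
      (1 - γ) * (1 - t1 - t2) - γ * (1 - t1 - t2) * ph ≤ (1 - t1 - t2) * (1 - γ / nu) := by
    by_cases hNd : N < d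
    · have hcompa : T < (l : ℝ) + h := by rw [hN, hd] at hNd; linarith
      have eph : ((l : ℝ) + h - T) / (T - 2 * (l : ℝ)) = (1 - nu) / nu := by
        rw [hnu, show (l : ℝ) + h - T = d - N by rw [hd, hN]; ring, ← hN, one_sub_div hd0.ne', div_div_div_cancel_right₀ hd0.ne']
      have e2 : (1 - γ) * (1 - t1 - t2) - γ * (1 - t1 - t2) * ((1 - nu) / nu) = (1 - t1 - t2) * (1 - γ / nu) := by field_simp; ring
      refine ⟨((l : ℝ) + h - T) / (T - 2 * (l : ℝ)), div_nonneg (by linarith) (by linarith), ?_, Or.inr hcompa, ?_, ?_⟩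
      · have e := GluedWindow.apow_heavy_valid y T 1 j l h hy0 hy1 hhj hlowl hcompa (by rw [← hN, ← hd]; exact hNyd)
        rw [one_mul] at e; exact e.le
      · rw [eph, e2]; exact mul_nonneg ht0p (by linarith)
      · rw [eph, e2]
    · refine ⟨0, le_rfl, by rw [zero_mul]; exact zero_le_one, Or.inl rfl, ?_, ?_⟩
      · rw [mul_zero, sub_zero]; exact mul_nonneg h1γ.le ht0p
      · have hn1 : 1 ≤ nu := by rw [hnu, le_div_iff₀ hd0]; linarith
        have : γ / nu ≤ γ := by rw [div_le_iff₀ hn0]; exact le_mul_of_one_le_right hγ0.le hn1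
        rw [mul_zero, sub_zero, mul_comm]
        exact mul_le_mul_of_nonneg_left (by linarith) ht0p
  -- the pool power of row l+r (plain or discounted) and the main inequality in capacity units
  have hCpos : 0 < γ * (t2 + t1) := mul_pos hγ0 (by linarith [lt_of_lt_of_le hy0 hyt2])
  obtain ⟨p1, hp10, vP1, hmain⟩ : ∃ p1 : ℝ, 0 < p1 ∧
      (p1 * (y / (1 - y)) ≤ 1 ∨ (T < ((l : ℝ) + r) + h ∧ p1 * usage y T j (l + r) h ≤ 1)) ∧
      ((1 - γ) * (1 - t1 - t2) - γ * (1 - t1 - t2) * ph) / pu + (1 - γ) * t1 / p1 ≤ γ * (t2 + t1) := by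
    by_cases hheavy1 : y * (d - r) ≤ N - 2 * r
    · -- middle copy heavy for h: plain pool rate; diag_twoCopy with ratios (ν, y)
      have hsum : (1 - t1 - t2) * nu + t1 * y ≤ ρ₀ := by
        have h1 : ((1 - t1 - t2) * nu + t1 * y) * d ≤ ρ₀ * d := by
          rw [eρ₀d, add_mul, mul_assoc, hnu, div_mul_cancel₀ _ hd0.ne']
          nlinarith [hAN, mul_le_mul_of_nonneg_left hheavy1 ht1p, mul_nonneg ht1p hr0]
        exact le_of_mul_le_mul_right h1 hd0
      have core := diag_twoCopy y ρ₀ (1 - t1 - t2) t1 nu y hy0 hy1 hρ₀0 ht0p ht1p (by linarith) hnuy le_rfl hsum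
      rw [← hγ, show 1 - (1 - t1 - t2) - t1 = t2 by ring] at core
      refine ⟨pu, hpu0, Or.inl vP, ?_⟩
      have e1 : ((1 - γ) * (1 - t1 - t2) - γ * (1 - t1 - t2) * ph) / pu ≤ (1 - t1 - t2) * (1 - γ / nu) * (y / (1 - y)) := by
        rw [epu]; exact mul_le_mul_of_nonneg_right hL0' (div_nonneg hy0.le h1y.le)
      have e2 : (1 - γ) * t1 / pu = t1 * (1 - γ / y) * (y / (1 - y)) + γ * t1 := by rw [hpu]; field_simp; ring
      have e3 : t2 * γ * ((1 - y) / y) * (y / (1 - y)) = γ * t2 := by field_simp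
      have e4 := mul_le_mul_of_nonneg_right core (div_nonneg hy0.le h1y.le)
      rw [add_mul, e3] at e4
      rw [e2]; linarith [e1, e4]
    · -- middle copy light for h, not lighter than the pair at T₀: discounted pool rate; diag_poolLight
      have hlight1 : N - 2 * (r : ℝ) < y * (d - r) := lt_of_not_ge hheavy1
      have hrhy : rh ≤ y := by rw [hrh, div_le_iff₀ hdr0]; linarith
      have hρrh : ρ₀ ≤ rh := by
        rcases hside with h1 | h1
        · exfalso; rw [hy, hN, hd, hT] at hlight1; linarith
        · rw [hrh, hρ₀, le_div_iff₀ hdr0, hd, hN, hT₀, hT, div_mul_eq_mul_div, div_le_iff₀ (by linarith : (0:ℝ) < (h:ℝ) - l)]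
          have e : a * (S + q * ((r : ℝ) + k * g)) - 2 * (l : ℝ) - 2 * r = a * (S + q * ((r : ℝ) + k * g)) - 2 * ((l : ℝ) + r) := by ring
          rw [show (h : ℝ) - l - r = (h : ℝ) - l - r by rfl, e]; nlinarith [h1]
      obtain ⟨Gh, hGh⟩ : ∃ Gh : ℝ, Gh = y ^ 2 + (1 - y) * rh := ⟨_, rfl⟩
      have hGhy : Gh ≤ y := by rw [hGh]; nlinarith [mul_le_mul_of_nonneg_left hrhy h1y.le]
      have hGh0 : 0 < Gh := by rw [hGh]; positivity
      have hGh1 : 0 < 1 - Gh := by linarith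
      obtain ⟨p1, hp1⟩ : ∃ p1 : ℝ, p1 = (1 - Gh) / Gh := ⟨_, rfl⟩
      have hp10 : 0 < p1 := by rw [hp1]; exact div_pos hGh1 hGh0
      have vlt : ((l + r : ℕ) : ℝ) < h := by rw [eLr]; linarith
      have hlight1' : T - 2 * ((l + r : ℕ) : ℝ) ≤ y * ((h : ℝ) - ((l + r : ℕ) : ℝ)) := by
        rw [eLr, show (h : ℝ) - ((l : ℝ) + r) = d - r by rw [hd]; ring]; rw [hN] at hlight1; linarith
      have vP1 : p1 * usage y T j (l + r) h ≤ 1 := by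
        have e := GluedWindow.apow_light_exact_valid y T 1 j (l + r) h hy0 hy1 hhj hlowlr vlt hlight1'
        rw [erh, ← hGh, ← hp1, one_mul] at e
        exact e.le
      have hsum : (1 - t1 - t2) * nu + t1 * rh ≤ ρ₀ := by
        -- ρ₀ d = N − A ≥ (1−t2)N − t1 r = t0 N + t1 (N − r) and (N − r)(d − r) ≥ (N − 2r) d  [N ≤ d + r]
        have hNr : rh * d ≤ N - r := by
          rw [hrh, div_mul_eq_mul_div, div_le_iff₀ hdr0]; nlinarith [hNdr.le, hr0]
        have h1 : ((1 - t1 - t2) * nu + t1 * rh) * d ≤ ρ₀ * d := by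
          rw [eρ₀d, add_mul, mul_assoc, hnu, div_mul_cancel₀ _ hd0.ne', mul_assoc]
          nlinarith [hAN, mul_le_mul_of_nonneg_left hNr ht1p]
        exact le_of_mul_le_mul_right h1 hd0
      have core := diag_poolLight y ρ₀ rh (1 - t1 - t2) t1 nu hy0 hy1 hρ₀0 hρrh hrhy hnuy hnu2 ht0p ht1p (by linarith) hsum
      rw [← hγ, ← hGh, show 1 - (1 - t1 - t2) - t1 = t2 by ring] at core
      refine ⟨p1, hp10, Or.inr ⟨by rw [← eLr]; exact hcomp1, vP1⟩, ?_⟩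
      have e1 : ((1 - γ) * (1 - t1 - t2) - γ * (1 - t1 - t2) * ph) / pu ≤ (1 - t1 - t2) * (1 - γ / nu) * (y / (1 - y)) := by
        rw [epu]; exact mul_le_mul_of_nonneg_right hL0' (div_nonneg hy0.le h1y.le)
      have e2 : (1 - γ) * t1 / p1 = t1 * (Gh - γ) / (1 - Gh) + γ * t1 := by rw [hp1]; field_simp; ring
      rw [e2]; linarith [e1, core]
  -- shares of the pool (capacity units)
  obtain ⟨σ, hσ0, hσ1, hc0, hc1⟩ := diag_share (((1 - γ) * (1 - t1 - t2) - γ * (1 - t1 - t2) * ph) / pu) ((1 - γ) * t1 / p1)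
    (γ * (t2 + t1)) hCpos (div_nonneg hL0 hpu0.le) (by
      have : 0 ≤ (1 - γ) * t1 / p1 := div_nonneg (mul_nonneg h1γ.le ht1p) hp10.le
      linarith [hmain]) hmain
  have hc0' : (1 - γ) * (1 - t1 - t2) - γ * (1 - t1 - t2) * ph ≤ σ * (γ * (t2 + 1 * t1) * pu) := by
    rw [div_le_iff₀ hpu0] at hc0; rw [one_mul]; linarith [hc0]
  have hc1' : (1 - γ) * t1 ≤ (1 - σ) * (γ * (t2 + 1 * t1) * p1) := by
    rw [div_le_iff₀ hp10] at hc1; rw [one_mul]; linarith [hc1]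
  have h1σ : 0 ≤ 1 - σ := by linarith
  refine gluedPullback_windowPair_twoRow_mid_of_assign x a q g S B r k j l h c ls α p 1 0 ph 0 pu 0 0 0 p1
    0 1 0 σ 0 0 0 (1 - σ)
    hx0 hx1 ha0 ha1 hq0 hq1 hg0 hg1 hr hlh hhB hwin hlow hcomp hL2j hL2mid hL1low hhmid (Or.inr ⟨hjr, rfl⟩) hhc hcB hcj hp hαp hcheap
    le_rfl hph0 le_rfl hpu0.le le_rfl le_rfl le_rfl hp10.le le_rfl zero_le_one le_rfl hσ0 le_rfl le_rfl le_rfl h1σ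
    (by linarith) (by linarith) (by linarith) (by linarith)
    ?_ (Or.inl rfl) ?_ ?_ ?_ (Or.inl rfl) (Or.inl ?_) ?_ (Or.inl rfl) ?_ (Or.inl rfl) ?_ (Or.inl rfl) ?_ ?_ ?_
  · rw [zero_mul]; exact zero_le_one
  · rw [← hy, ← hT]; exact vH
  · rw [← hT]; exact hcH
  · rw [zero_mul]; exact zero_le_one
  · rw [← hy]; exact vP
  · rw [zero_mul]; exact zero_le_one
  · rw [zero_mul]; exact zero_le_one
  · rw [zero_mul]; exact zero_le_one
  · rw [← hy, ← hT]; exact vP1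
  · rw [hγ', ← ht1, ← ht2, ← et0]
    have e : 0 * ((1 - γ) * t2 * 0) + 1 * (γ * (1 - t1 - t2) * ph) + 0 * (γ * t1 * (1 - 1) * 0) + σ * (γ * (t2 + 1 * t1) * pu)
        = γ * (1 - t1 - t2) * ph + σ * (γ * (t2 + 1 * t1) * pu) := by ring
    rw [e]; linarith [hc0']
  · rw [hγ', ← ht1, ← ht2]
    have e : 0 * ((1 - γ) * t2 * 0) + 0 * (γ * (1 - q) * 0) + 0 * (γ * t1 * (1 - 1) * 0) + (1 - σ) * (γ * (t2 + 1 * t1) * p1)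
        = (1 - σ) * (γ * (t2 + 1 * t1) * p1) := by ring
    rw [e]; exact hc1'

end LawDec
end Quant
end Summit.CriticalPhenomena.PercolationContinuityZ3.Theorems
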